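import Summits.BirchSwinnertonDyer.BirchSwinnertonDyer.Theorems.SignedLowerHalvesSmallImageLowerHalfBothSignsRttOneSidedCruxTieredSupply
import Summits.BirchSwinnertonDyer.BirchSwinnertonDyer.Theorems.SignedLowerHalvesSmallImageLowerHalfBothSignsRttOneSidedCrux
import HarnessLib

/-!
# Route `SignedLowerHalves`, crux L `SmallImageLowerHalfBothSigns` (item stmt-BirchSwinnertonDyer-23599), line `rtt_w3` v4:
# crux L BY NAME with the engine TIERED, part B — T1 (CM-curve partner) DISCHARGED IN THE KERNEL, ENG only asked on T2

LEAD `cruxlead-stmt-BirchSwinnertonDyer-23599` g2 (cell `bsd-ssimc`); helper `--supports stmt-BirchSwinnertonDyer-23599`;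
THEOREMS ONLY — no definition, no named fact, no `sorry`; a sorry-free SKELETON-SHAPED composition, not a proof of crux L;
BSD is not proved by any of this.

HONEST FRAMING. v3 (`…RttOneSidedCrux`, p741163) concludes crux L BY NAME from print ∧ the one-sign `μ`-floor at `p ≥ 5` ∧
K0₂ ∧ Kan₂ ∧ the ONE-SIDED engine, split as AN_W (landed p744056) ∧ ENG (`stub_partnerLayerLambdaLower_ns`, quantified over
EVERY level-matched CM partner). ENG is PROVED for a CM-CURVE partner `g = f_A` (`…RttEngineCMCurve`, p745857, from Kobayashi
Thm 1.2, B. D. Kim 2009 Cor 2.13 and Pollack–Rubin 2004 by name) — tier T1, 79 of the 136 open census pairs. This file makes the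
T1 discharge VISIBLE IN THE COMPOSITION: the one-sided transport is proved from a FIXED partner (§1); on a pair `(W, p)` that HAS a
CM elliptic curve `A/ℚ` (good supersingular at `p`, `a_p(A) = 0`, `A[p] ≃ W[p]` `Γ_ℚ`-equivariantly) the partner is `f_A` itself —
§2 supplies every K0₂-clause for it from tree theorems (modularity `exists_isNewformOf` by name; level clause = p742955's
`levelMatch`; trace congruence = Kraus–Oesterlé; CM form = `isCMForm_liftToGamma1_of_isNewformOf_of_hasCM`; cohomological period =
`CohomologicalPeriod.exists_isCohomologicalPlusPeriod`; Pollack pair = `pollack_exists_plusMinusPAdicLFunction_holds`; `ϖ_A` = the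
period-unit facts `h5`/`h3`) and ENG is the landed T1 theorem; on the other pairs (T2) the partner is K0₂'s and ENG is asked ONLY
THERE (`hENG2` = the registered ENG text with the extra hypothesis «no CM-curve partner»). §4 = v3's class-wide theorem with this
tiered transport: crux L BY NAME from the v4 stub texts.

* (part A, `…RttOneSidedCruxTieredSupply`) §1 `lamTransport_le_of_partner` (fixed partner) and §2 `cmCurvePartner_supply` (T1).
* §3 `lamTransport_le_tiered` — the transport on the class from Kan₂ ∧ ENG_T2 (T1/T2 case split).
* §4 `smallImageLowerHalfBothSigns_of_oneSignFloor_of_rtt_ge_tiered` — crux L BY NAME (v4 composition target).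

References: [Kobayashi2003] Thm. 1.2, 4.1, 7.4, Conjecture (p. 2); [BDKim2009] Cor. 2.13; [PollackRubin2004] Theorem (p. 448);
[KrausOesterle1992] §3 Prop. 3; [Ribet1977Nebentypus] §3; [PollackWeston2011MT] Def. 2.1, §3.1, Thm. 4.1; [GreenbergVatsal2000] Prop. (2.4),
§3 Rem. 3.4; [BreuilConradDiamondTaylor2001] Thm. A; [Pollack2003] Thm. 5.6, Prop. 6.18.
-/

set_option autoImplicit false
-- D-0017: single-problem summit, the namespace repeats the problem name by design.
set_option linter.dupNamespace false
noncomputable section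

open scoped Classical MatrixGroups ModularForm BigOperators

open CongruenceSubgroup WeierstrassCurve Field Polynomial NumberField IsDedekindDomain
  Literature.NumberTheory.EllipticCurves Literature.NumberTheory.EllipticCurves.ModularForms
  Literature.NumberTheory.EllipticCurves.Rank1Residual
  Literature.NumberTheory.EllipticCurves.Kobayashi2003
  Literature.NumberTheory.EllipticCurves.GreenbergVatsal2000 ZpExtension
  Literature.NumberTheory.IwasawaTheory Rat.HeightOneSpectrum
  Summit.BirchSwinnertonDyer.Rank1Residual.Supersingular
  Summit.BirchSwinnertonDyer.Rank1Residual.X1.MuLambda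
  Summit.BirchSwinnertonDyer.Rank1Residual.X2.EulerFactorInvariants
  Summit.BirchSwinnertonDyer.BirchSwinnertonDyer.Theorems.SmallImageLambdaLowerThreeNsThetaTransport

namespace Summit.BirchSwinnertonDyer.BirchSwinnertonDyer.Theorems.SmallImageRttOneSided

/-! ## §3 The tiered transport on the class: T1 by the landed engine, T2 by ENG_T2 -/

section Tiered

/-- **The one-sided λ-transport on the small-image class from Kan₂ ∧ ENG_T2, TIERED.** Granted by name: Kobayashi Thm 1.2 (`h12`),
B. D. Kim 2009 Cor 2.13 (`hKim`), Pollack–Rubin 2004 (`hPR`), modularity (`hmod`), Deligne/Carayol/Saito (`hD hC hS`), the period units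
(`h5 h3`); and the two registered stub texts Kan₂ (`hKan`, every level-matched partner) and ENG_T2 (`hENG2` = ENG asked only on pairs
WITHOUT a CM-curve partner). Then for every class pair `(W, p)` and sign `ε` the transport `λ(G) ≤ λ(X^ε_W)` holds: if a CM curve `A`
with `A[p] ≃ W[p]` exists (T1) the partner is `f_A` (§2) and ENG is the LANDED `partnerLayerLambdaLower_of_cmCurvePartner` (p745857);
otherwise (T2) the partner is K0₂'s (`stub_heckeThetaPartner_ns`, p741818, level clause p742955) and ENG is `hENG2`. CONDITIONAL;
closes nothing. [cite: BDKim2009, Cor. 2.13] [cite: PollackRubin2004, Theorem (p. 448)] [cite: PollackWeston2011MT, §3.1, Thm. 4.1 (1)] -/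
theorem lamTransport_le_tiered
    (h12 : thm12_signedSelmerDual_finite_torsion)
    (hKim : BDKim2009.cor213_signedLambda_add_sum_delta_eq_of_torsionIso)
    (hPR : PollackRubin2004.mainTheorem_signedCharIdeal_eq_of_cm) (hmod : exists_isNewformOf)
    (hD : Hida2000_thm326_exists_galoisRep) (hC : Carayol1986_artinConductorExponent)
    (hS : ∀ (V : WeierstrassCurve ℚ) (ℓ : ℕ) [Fact ℓ.Prime],
      V.swanConductorAt_rationalTate_eq_wildConductorExponent_of_ringChar_eq_two ℓ)
    (h5 : realPeriodRat_eq_unit_mul_plusPeriod) (h3 : realPeriodRat_eq_unit_mul_plusPeriod_three)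
    (hKan : ∀ (W : WeierstrassCurve ℚ) [W.IsElliptic] [W.IsGloballyMinimal] (p : ℕ) [Fact p.Prime],
      p ≠ 2 → ClassX7 W p → ¬ W.HasCM → W.frobeniusTrace p = 0 → ¬ Surj W p →
      ∀ (ε : ℤˣ), ∀ (M : ℕ) [NeZero M] (g : CuspForm (Gamma0 M) 2) (ι : coeffField g →+* PadicAlgCl p) (Ω : ℂ),
        ¬ p ∣ M → (∀ ℓ : ℕ, ℓ.Prime → ℓ ≠ p → max 2 (padicValNat ℓ M) = max 2 (padicValNat ℓ (W.conductorNorm ℤ))) →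
        IsNewform0 g → Literature.NumberTheory.Automorphic.IsCMForm (liftToGamma1 M 2 g) →
        cuspCoeff g p = 0 → IsPlusPeriod g Ω →
        (∀ ℓ : ℕ, ℓ.Prime → ¬ ℓ ∣ p * M * W.conductorNorm ℤ →
          ‖embCoeff g ι ℓ - (W.frobeniusTrace ℓ : PadicAlgCl p)‖ < 1) →
        ∀ [NeZero (W.conductorNorm ℤ)] (f : CuspForm (Gamma0 (W.conductorNorm ℤ)) 2), IsNewformOf W f →
        ∀ (Lplus Lminus : IwasawaAlgebra p), IsPollackPair f p Lplus Lminus →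
          HasUnitContent (kobayashiL ε Lplus Lminus) →
        ∀ (S₀ : Finset (HeightOneSpectrum (𝓞 ℚ))), (∀ v ∈ S₀, ((p : ℕ) : 𝓞 ℚ) ∉ v.asIdeal) →
          (∀ v : HeightOneSpectrum (𝓞 ℚ), ¬ W.HasGoodReductionAt v → v ∈ S₀) →
          (∀ v : HeightOneSpectrum (𝓞 ℚ), natGenerator v ∣ M → v ∈ S₀) →
        ∃ n₀ : ℕ, ∀ n ≥ n₀, (Even n ↔ ε = 1) →
          layerLambda (((mazurTateElement f p n).map (algebraMap ℚ (PadicAlgCl p)) *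
              ∏ v ∈ S₀, ((W.localPolynomialAt v).map (Int.castRingHom (PadicAlgCl p))).comp
                (C ((natGenerator v : PadicAlgCl p)⁻¹) *
                  (X + 1) ^ (PadicInt.toZModPow n (-(frobeniusExponent p (natGenerator v : ℤ_[p])))).val)) %ₘ
              ((X + 1) ^ p ^ n - 1)) =
          layerLambda (((mazurTateElementK g Ω p n).map ι *
              ∏ v ∈ S₀, (1 - C (embCoeff g ι (natGenerator v)) * X +
                  (if natGenerator v ∣ M then 0 else C (natGenerator v : PadicAlgCl p)) * X ^ 2).comp
                (C ((natGenerator v : PadicAlgCl p)⁻¹) *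
                  (X + 1) ^ (PadicInt.toZModPow n (-(frobeniusExponent p (natGenerator v : ℤ_[p])))).val)) %ₘ
              ((X + 1) ^ p ^ n - 1)))
    (hENG2 : ∀ (W : WeierstrassCurve ℚ) [W.IsElliptic] [W.IsGloballyMinimal] (p : ℕ) [Fact p.Prime],
      p ≠ 2 → ClassX7 W p → ¬ W.HasCM → W.frobeniusTrace p = 0 → ¬ Surj W p →
      ¬ (∃ (A : WeierstrassCurve ℚ) (_ : A.IsElliptic) (_ : A.IsGloballyMinimal),
        A.HasCM ∧ GoodSS A p ∧ A.frobeniusTrace p = 0 ∧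
          ∃ e : geomTorsion W (p : ℤ) ≃+ geomTorsion A (p : ℤ),
            ∀ (σ : absoluteGaloisGroup ℚ) (P : geomTorsion W (p : ℤ)), e (σ • P) = σ • e P) →
      ∀ (ε : ℤˣ), ∀ (M : ℕ) [NeZero M] (g : CuspForm (Gamma0 M) 2) (ι : coeffField g →+* PadicAlgCl p) (Ω : ℂ),
        ¬ p ∣ M → (∀ ℓ : ℕ, ℓ.Prime → ℓ ≠ p → max 2 (padicValNat ℓ M) = max 2 (padicValNat ℓ (W.conductorNorm ℤ))) →
        IsNewform0 g → Literature.NumberTheory.Automorphic.IsCMForm (liftToGamma1 M 2 g) →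
        cuspCoeff g p = 0 → IsCohomologicalPlusPeriod g ι Ω →
        (∀ ℓ : ℕ, ℓ.Prime → ¬ ℓ ∣ p * M * W.conductorNorm ℤ →
          ‖embCoeff g ι ℓ - (W.frobeniusTrace ℓ : PadicAlgCl p)‖ < 1) →
        ∀ (κ : ZpExtension ℚ p) (γ : absoluteGaloisGroup ℚ),
          κ.IsCyclotomic → κ.IsTopGenerator γ → IsCyclotomicVariable p γ →
        ∀ (S₀ : Finset (HeightOneSpectrum (𝓞 ℚ))), (∀ v ∈ S₀, ((p : ℕ) : 𝓞 ℚ) ∉ v.asIdeal) →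
          (∀ v : HeightOneSpectrum (𝓞 ℚ), ¬ W.HasGoodReductionAt v → v ∈ S₀) →
          (∀ v : HeightOneSpectrum (𝓞 ℚ), natGenerator v ∣ M → v ∈ S₀) →
        ∀ (D : SignedSelmerDualData W κ γ ε) [Module.Finite (IwasawaAlgebra p) D.X],
          Module.IsTorsion (IwasawaAlgebra p) D.X → D.mu = 0 →
        ∃ n₀ : ℕ, ∀ n ≥ n₀, (Even n ↔ ε = 1) →
          ((layerLambda (((mazurTateElementK g Ω p n).map ι *
              ∏ v ∈ S₀, (1 - C (embCoeff g ι (natGenerator v)) * X +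
                  (if natGenerator v ∣ M then 0 else C (natGenerator v : PadicAlgCl p)) * X ^ 2).comp
                (C ((natGenerator v : PadicAlgCl p)⁻¹) *
                  (X + 1) ^ (PadicInt.toZModPow n (-(frobeniusExponent p (natGenerator v : ℤ_[p])))).val)) %ₘ
              ((X + 1) ^ p ^ n - 1)) : ℕ) : ℤ) ≤
            ((if ε = 1 then cyclotomicOmegaMinus p n else cyclotomicOmegaPlus p n).natDegree : ℤ) +
              ((lambdaInvariant p D.X : ℕ) : ℤ) + ((∑ v ∈ S₀, delta W p v : ℕ) : ℤ))
    (W : WeierstrassCurve ℚ) [W.IsElliptic] [W.IsGloballyMinimal] (p : ℕ) [Fact p.Prime]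
    (hp : p ≠ 2) (hX : ClassX7 W p) (hcm : ¬ W.HasCM) (hap : W.frobeniusTrace p = 0) (hs : ¬ Surj W p) (ε : ℤˣ) :
    ∀ (κ : ZpExtension ℚ p) (γ : absoluteGaloisGroup ℚ),
      κ.IsCyclotomic → κ.IsTopGenerator γ → IsCyclotomicVariable p γ →
      ∀ [NeZero (W.conductorNorm ℤ)] (f : CuspForm (Gamma0 (W.conductorNorm ℤ)) 2),
        IsNewformOf W f → ∀ (ϖ : ℚ), (ϖ : ℝ) * W.realPeriodRat = plusPeriod f →
      ∀ (Lplus Lminus : IwasawaAlgebra p), IsPollackPair f p Lplus Lminus →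
        HasUnitContent (kobayashiL ε Lplus Lminus) →
      ∀ (D : SignedSelmerDualData W κ γ ε) [Module.Finite (IwasawaAlgebra p) D.X],
        Module.IsTorsion (IwasawaAlgebra p) D.X → D.mu = 0 →
      ∀ (G : IwasawaAlgebra p) (m : ℕ),
        iwasawaToPowerSeries p G =
          PowerSeries.C ((p : ℚ_[p]) ^ m * (ϖ : ℚ_[p])) * iwasawaToPowerSeries p (kobayashiL ε Lplus Lminus) →
        lam G ≤ lambdaInvariant p D.X := by
  have hgood : W.HasGoodReductionAtPrime p := hX.1.1
  by_cases hT1 : (∃ (A : WeierstrassCurve ℚ) (_ : A.IsElliptic) (_ : A.IsGloballyMinimal),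
        A.HasCM ∧ GoodSS A p ∧ A.frobeniusTrace p = 0 ∧
          ∃ e : geomTorsion W (p : ℤ) ≃+ geomTorsion A (p : ℤ),
            ∀ (σ : absoluteGaloisGroup ℚ) (P : geomTorsion W (p : ℤ)), e (σ • P) = σ • e P)
  · -- T1: the partner is `f_A`, ENG is the landed CM-curve engine
    obtain ⟨A, iA₁, iA₂, hcmA, hssA, hapA, he⟩ := hT1
    obtain ⟨iN, g, ι, Ω, hg, hpN, hlev, hnew, hcmg, hapg, hΩ, hcong, ⟨ϖA, hϖA⟩, hPol⟩ :=
      cmCurvePartner_supply hD hC hS hmod h5 h3 W A p hp hgood hcmA hssA hapA he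
    intro κ γ hκ hγ hγ' _ f hf ϖ hϖ Lplus Lminus hPP hfl D _ hXt hμ G m hG
    exact lamTransport_le_of_partner W p hp hgood ε g ι Ω hpN
      (hKan W p hp hX hcm hap hs ε (A.conductorNorm ℤ) g ι Ω hpN hlev hnew hcmg hapg hΩ.isPlusPeriod hcong)
      (fun κ γ hκ hγ hγ' S₀ hS₀p hS₀W hS₀A D _ hXt hμ ↦
        partnerLayerLambdaLower_of_cmCurvePartner h12 hKim hPR W A p hp hgood hap hcmA hssA hapA he g hg ι Ω
          hΩ.isPlusPeriod ϖA hϖA hPol ε κ γ hκ hγ hγ' S₀ hS₀p hS₀W hS₀A D hXt hμ)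
      κ γ hκ hγ hγ' f hf ϖ hϖ Lplus Lminus hPP hfl D hXt hμ G m hG
  · -- T2: the partner is K0₂'s, ENG is the stub ENG_T2
    obtain ⟨M, hM, g, ι, Ω, hpM, hnew, hcmg, hapg, hΩ, hcong⟩ :=
      Summit.BirchSwinnertonDyer.BirchSwinnertonDyer.Theorems.SmallImageLambdaLowerThreeNsThetaPartner.stub_heckeThetaPartner_ns
        W p hp hX hcm hap hs
    haveI := hM
    have hlev : ∀ ℓ : ℕ, ℓ.Prime → ℓ ≠ p → max 2 (padicValNat ℓ M) = max 2 (padicValNat ℓ (W.conductorNorm ℤ)) :=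
      Summit.BirchSwinnertonDyer.BirchSwinnertonDyer.Theorems.SmallImageLambdaLowerThreeNsThetaPartner.stub_levelMatch_ns hD hC hS
        W p hp hX hcm hap hs M g ι hpM hnew hcmg hcong
    intro κ γ hκ hγ hγ' _ f hf ϖ hϖ Lplus Lminus hPP hfl D _ hXt hμ G m hG
    exact lamTransport_le_of_partner W p hp hgood ε g ι Ω hpM
      (hKan W p hp hX hcm hap hs ε M g ι Ω hpM hlev hnew hcmg hapg hΩ.isPlusPeriod hcong)
      (hENG2 W p hp hX hcm hap hs hT1 ε M g ι Ω hpM hlev hnew hcmg hapg hΩ hcong)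
      κ γ hκ hγ hγ' f hf ϖ hϖ Lplus Lminus hPP hfl D hXt hμ G m hG

end Tiered

/-! ## §4 CLASS-WIDE: crux L BY NAME from print ∧ (one-sign floor at `p ≥ 5`) ∧ Kan₂ ∧ ENG_T2 (v4 composition target) -/

section ClassWide

/-- **Crux L `SmallImageLowerHalfBothSigns` BY NAME ⟸ print ∧ (one-sign floor at `p ≥ 5` = `stub_muOneSign_ns_ge5` VERBATIM) ∧
Kan₂ ∧ ENG_T2** — v3's `smallImageLowerHalfBothSigns_of_oneSignFloor_of_rtt_ge` (p741163) with K0₂ INTERNAL (landed p741818 +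
p742955) and the engine TIERED (§3): the CM-curve-partner tranche T1 is discharged by the landed engine, ENG is displayed only as
ENG_T2. Displayed print: `hJ h12 h41 h5 h3` (Kobayashi, period units), `hD hC hS` (Deligne/Hida, Carayol, Saito@2), `hmod` (modularity),
`hKim` (B. D. Kim 2009 Cor 2.13), `hPR` (Pollack–Rubin 2004) — the v4 cite stub's conjuncts; `hfloor5`, `hKan`, `hENG2` = the v4 stubs.
`p = 3`: floor = THEOREM B (part 1′); `5 ≤ p`: sign idleness on X7. A sorry-free line-shaped decomposition; CONDITIONAL; closes nothing;
crux L / BSD NOT proved. [cite: Kobayashi2003, Conjecture (p. 2), Thm. 7.4 (p. 13)] [cite: Pollack2003, Conj. 6.3]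
[cite: BDKim2009, Cor. 2.13] [cite: PollackRubin2004, Theorem (p. 448)] [cite: PollackWeston2011MT, §3.1, Thm. 4.1 (1)] -/
theorem smallImageLowerHalfBothSigns_of_oneSignFloor_of_rtt_ge_tiered
    (hJ : thm62_63_73_signedColemanKato_zetaJoint) (h12 : thm12_signedSelmerDual_finite_torsion)
    (h41 : thm41_signedCharIdeal_divisibility)
    (h5 : realPeriodRat_eq_unit_mul_plusPeriod) (h3 : realPeriodRat_eq_unit_mul_plusPeriod_three)
    (hD : Hida2000_thm326_exists_galoisRep) (hC : Carayol1986_artinConductorExponent)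
    (hS : ∀ (V : WeierstrassCurve ℚ) (ℓ : ℕ) [Fact ℓ.Prime],
      V.swanConductorAt_rationalTate_eq_wildConductorExponent_of_ringChar_eq_two ℓ)
    (hmod : exists_isNewformOf)
    (hKim : BDKim2009.cor213_signedLambda_add_sum_delta_eq_of_torsionIso)
    (hPR : PollackRubin2004.mainTheorem_signedCharIdeal_eq_of_cm)
    (hfloor5 : ∀ (W : WeierstrassCurve ℚ) [W.IsElliptic] [W.IsGloballyMinimal] (p : ℕ) [Fact p.Prime],
      5 ≤ p → ClassX7 W p → ¬ W.HasCM → W.frobeniusTrace p = 0 → ¬ Surj W p →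
      ∀ [NeZero (W.conductorNorm ℤ)] (f : CuspForm (Gamma0 (W.conductorNorm ℤ)) 2),
        IsNewformOf W f → ∃ (ε₀ : ℤˣ) (L₀ : IwasawaAlgebra p), IsSignedPAdicLFunction f p ε₀ L₀ ∧ HasUnitContent L₀)
    (hKan : ∀ (W : WeierstrassCurve ℚ) [W.IsElliptic] [W.IsGloballyMinimal] (p : ℕ) [Fact p.Prime],
      p ≠ 2 → ClassX7 W p → ¬ W.HasCM → W.frobeniusTrace p = 0 → ¬ Surj W p →
      ∀ (ε : ℤˣ), ∀ (M : ℕ) [NeZero M] (g : CuspForm (Gamma0 M) 2) (ι : coeffField g →+* PadicAlgCl p) (Ω : ℂ),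
        ¬ p ∣ M → (∀ ℓ : ℕ, ℓ.Prime → ℓ ≠ p → max 2 (padicValNat ℓ M) = max 2 (padicValNat ℓ (W.conductorNorm ℤ))) →
        IsNewform0 g → Literature.NumberTheory.Automorphic.IsCMForm (liftToGamma1 M 2 g) →
        cuspCoeff g p = 0 → IsPlusPeriod g Ω →
        (∀ ℓ : ℕ, ℓ.Prime → ¬ ℓ ∣ p * M * W.conductorNorm ℤ →
          ‖embCoeff g ι ℓ - (W.frobeniusTrace ℓ : PadicAlgCl p)‖ < 1) →
        ∀ [NeZero (W.conductorNorm ℤ)] (f : CuspForm (Gamma0 (W.conductorNorm ℤ)) 2), IsNewformOf W f →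
        ∀ (Lplus Lminus : IwasawaAlgebra p), IsPollackPair f p Lplus Lminus →
          HasUnitContent (kobayashiL ε Lplus Lminus) →
        ∀ (S₀ : Finset (HeightOneSpectrum (𝓞 ℚ))), (∀ v ∈ S₀, ((p : ℕ) : 𝓞 ℚ) ∉ v.asIdeal) →
          (∀ v : HeightOneSpectrum (𝓞 ℚ), ¬ W.HasGoodReductionAt v → v ∈ S₀) →
          (∀ v : HeightOneSpectrum (𝓞 ℚ), natGenerator v ∣ M → v ∈ S₀) →
        ∃ n₀ : ℕ, ∀ n ≥ n₀, (Even n ↔ ε = 1) →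
          layerLambda (((mazurTateElement f p n).map (algebraMap ℚ (PadicAlgCl p)) *
              ∏ v ∈ S₀, ((W.localPolynomialAt v).map (Int.castRingHom (PadicAlgCl p))).comp
                (C ((natGenerator v : PadicAlgCl p)⁻¹) *
                  (X + 1) ^ (PadicInt.toZModPow n (-(frobeniusExponent p (natGenerator v : ℤ_[p])))).val)) %ₘ
              ((X + 1) ^ p ^ n - 1)) =
          layerLambda (((mazurTateElementK g Ω p n).map ι *
              ∏ v ∈ S₀, (1 - C (embCoeff g ι (natGenerator v)) * X +
                  (if natGenerator v ∣ M then 0 else C (natGenerator v : PadicAlgCl p)) * X ^ 2).comp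
                (C ((natGenerator v : PadicAlgCl p)⁻¹) *
                  (X + 1) ^ (PadicInt.toZModPow n (-(frobeniusExponent p (natGenerator v : ℤ_[p])))).val)) %ₘ
              ((X + 1) ^ p ^ n - 1)))
    (hENG2 : ∀ (W : WeierstrassCurve ℚ) [W.IsElliptic] [W.IsGloballyMinimal] (p : ℕ) [Fact p.Prime],
      p ≠ 2 → ClassX7 W p → ¬ W.HasCM → W.frobeniusTrace p = 0 → ¬ Surj W p →
      ¬ (∃ (A : WeierstrassCurve ℚ) (_ : A.IsElliptic) (_ : A.IsGloballyMinimal),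
        A.HasCM ∧ GoodSS A p ∧ A.frobeniusTrace p = 0 ∧
          ∃ e : geomTorsion W (p : ℤ) ≃+ geomTorsion A (p : ℤ),
            ∀ (σ : absoluteGaloisGroup ℚ) (P : geomTorsion W (p : ℤ)), e (σ • P) = σ • e P) →
      ∀ (ε : ℤˣ), ∀ (M : ℕ) [NeZero M] (g : CuspForm (Gamma0 M) 2) (ι : coeffField g →+* PadicAlgCl p) (Ω : ℂ),
        ¬ p ∣ M → (∀ ℓ : ℕ, ℓ.Prime → ℓ ≠ p → max 2 (padicValNat ℓ M) = max 2 (padicValNat ℓ (W.conductorNorm ℤ))) →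
        IsNewform0 g → Literature.NumberTheory.Automorphic.IsCMForm (liftToGamma1 M 2 g) →
        cuspCoeff g p = 0 → IsCohomologicalPlusPeriod g ι Ω →
        (∀ ℓ : ℕ, ℓ.Prime → ¬ ℓ ∣ p * M * W.conductorNorm ℤ →
          ‖embCoeff g ι ℓ - (W.frobeniusTrace ℓ : PadicAlgCl p)‖ < 1) →
        ∀ (κ : ZpExtension ℚ p) (γ : absoluteGaloisGroup ℚ),
          κ.IsCyclotomic → κ.IsTopGenerator γ → IsCyclotomicVariable p γ →
        ∀ (S₀ : Finset (HeightOneSpectrum (𝓞 ℚ))), (∀ v ∈ S₀, ((p : ℕ) : 𝓞 ℚ) ∉ v.asIdeal) →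
          (∀ v : HeightOneSpectrum (𝓞 ℚ), ¬ W.HasGoodReductionAt v → v ∈ S₀) →
          (∀ v : HeightOneSpectrum (𝓞 ℚ), natGenerator v ∣ M → v ∈ S₀) →
        ∀ (D : SignedSelmerDualData W κ γ ε) [Module.Finite (IwasawaAlgebra p) D.X],
          Module.IsTorsion (IwasawaAlgebra p) D.X → D.mu = 0 →
        ∃ n₀ : ℕ, ∀ n ≥ n₀, (Even n ↔ ε = 1) →
          ((layerLambda (((mazurTateElementK g Ω p n).map ι *
              ∏ v ∈ S₀, (1 - C (embCoeff g ι (natGenerator v)) * X +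
                  (if natGenerator v ∣ M then 0 else C (natGenerator v : PadicAlgCl p)) * X ^ 2).comp
                (C ((natGenerator v : PadicAlgCl p)⁻¹) *
                  (X + 1) ^ (PadicInt.toZModPow n (-(frobeniusExponent p (natGenerator v : ℤ_[p])))).val)) %ₘ
              ((X + 1) ^ p ^ n - 1)) : ℕ) : ℤ) ≤
            ((if ε = 1 then cyclotomicOmegaMinus p n else cyclotomicOmegaPlus p n).natDegree : ℤ) +
              ((lambdaInvariant p D.X : ℕ) : ℤ) + ((∑ v ∈ S₀, delta W p v : ℕ) : ℤ)) :
    Summit.BirchSwinnertonDyer.BirchSwinnertonDyer.Theses.SignedLowerHalves.SmallImageLowerHalfBothSigns := by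
  intro W _ _ p _ hp2 hX hCM hap hs ε
  have hT := lamTransport_le_tiered h12 hKim hPR hmod hD hC hS h5 h3 hKan hENG2 W p hp2 hX hCM hap hs
  by_cases hp3 : p = 3
  · exact forall_kobayashiLowerDivisibility_three_of_lamTransport_le W p hp3 hJ h12 h41 h5 h3 hX hap hs
      (fun ε' κ γ hκ hγ hγ' _ f hf ϖ hϖ Lplus Lminus hPP hfl D _ hXt hμ G m hG ↦
        hT ε' κ γ hκ hγ hγ' f hf ϖ hϖ Lplus Lminus hPP hfl D hXt hμ G m hG) ε
  · have hp5 : 5 ≤ p := by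
      have h2 := (Fact.out : p.Prime).two_le
      by_contra h
      interval_cases p
      · exact hp2 rfl
      · exact hp3 rfl
      · exact absurd (Fact.out : Nat.Prime 4) (by decide)
    obtain ⟨ε₀, hε₀⟩ := LargeImageMuFloor.exists_sign_forall_isNewformOf (W := W)
      (fun ε f ↦ ∃ L₀ : IwasawaAlgebra p, IsSignedPAdicLFunction f p ε L₀ ∧ HasUnitContent L₀)
      (fun f hf ↦ hfloor5 W p hp5 hX hCM hap hs f hf)
    have hfl : ∀ [NeZero (W.conductorNorm ℤ)] (f : CuspForm (Gamma0 (W.conductorNorm ℤ)) 2), IsNewformOf W f →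
        ∀ Lplus Lminus : IwasawaAlgebra p, IsPollackPair f p Lplus Lminus →
          HasUnitContent (kobayashiL ε₀ Lplus Lminus) := by
      intro _ f hf Lplus Lminus hPP
      obtain ⟨L₀, hL₀, hu⟩ := hε₀ f hf
      rwa [IsSignedPAdicLFunction.unique hL₀ (hPP.isSignedPAdicLFunction_kobayashiL ε₀)] at hu
    have hMC : KobayashiMainConjecture W p ε₀ :=
      kobayashiMainConjecture_of_lamTransport_le W p hp2 (thm62_63_73_signedColemanKato_zeta_of_joint hJ) h12 h41 h5 h3
        hX.1.1 hap hs ε₀ (fun f hf Lplus Lminus hPP ↦ hfl f hf Lplus Lminus hPP)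
        (fun κ γ hκ hγ hγ' _ f hf ϖ hϖ Lplus Lminus hPP D _ hXt hμ G m hG ↦
          hT ε₀ κ γ hκ hγ hγ' f hf ϖ hϖ Lplus Lminus hPP (hfl f hf Lplus Lminus hPP) D hXt hμ G m hG)
    exact (SignDefect.X7.exists_kobayashiLowerDivisibility_iff_forall W p h12 h5 h3 hJ hp2 hX hap).mp
      ⟨ε₀, kobayashiLowerDivisibility_of_mainConjecture hMC⟩ ε

end ClassWide

end Summit.BirchSwinnertonDyer.BirchSwinnertonDyer.Theorems.SmallImageRttOneSided

end
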